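import Summits.AtomisticToContinuum.HydrodynamicLimit.Theorems.RelayRaceLocalityNearConstantShortTimeHLSmallTiltGronwallDefs
import Summits.AtomisticToContinuum.HydrodynamicLimit.Theorems.RelayRaceLocalityNearConstantShortTimeHLGeneralFamilyLDA
import Summits.AtomisticToContinuum.HydrodynamicLimit.Theorems.DenseExcursion.Negative.Everywhere
import HarnessLib

/-!
# Crux `NearConstantShortTimeHL` (stmt-AtomisticToContinuum-12502), line `small-tilt-domination` — stub `stub_uniformPressure` (St3)

Support file (`--supports stmt-AtomisticToContinuum-12502`) proving the registered stub

  `stub_uniformPressure : UniformPressureAlongSolution`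

of the line `small-tilt-domination` (typed statement `UniformPressureAlongSolution` in
`…NearConstantShortTimeHLSmallTiltGronwallDefs.lean`, statics input St3 of the lead's Gronwall `stub_meanFieldGronwall`):
along a classical hs-Euler solution `(ρ, u, θ)` of unit mass in the dilute band, the pressures per particle
`n_N⁻¹ log Z_N(ψ^E_r)` of the Euler-MATCHED canonical local Gibbs laws (profile `localGibbsProfile (ρ_r e^{g_σ(ρ_r)}) u_r θ_r`)
converge to `∫ ρ_r · ρ_r σ³ f_ex′(ρ_r σ³)` UNIFORMLY in `r ∈ [0, t]`.

The argument (no dynamics beyond mass conservation, no derivatives):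

1. POINTWISE in `r`: `GeneralFamilyLDA` (i) (`stub_ldaGeneralFamilies`, landed) at the profile `(ρ_r, u_r, θ_r)` — the
   slice is continuous and positive on the compact torus (lower bound = its minimum), the band comes from the packing
   guard, and `∫ρ_r = ∫ρ_0 = 1` by mass conservation (`DenseExcursionEverywhere.integral_density_eq`);
2. EQUICONTINUITY in `r`, uniformly in `N`: the partition function of a local Gibbs profile is the configurational one
   of its ACTIVITY `a_r = ρ_r e^{g_σ(ρ_r)} = exp(log ρ_r + g_σ(ρ_r))` (`canonicalPartition_eq_posPartition`: the
   Maxwellians are normalised); the exponent `(r, x) ↦ log ρ_r(x) + g_σ(ρ_r(x))` is continuous on the compact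
   `[0, t] × 𝕋³` (joint smoothness of the solution; `f_ex` is analytic on the band, `hsEosLowDensity_proof`), hence
   uniformly continuous, so `a_r ≤ e^{ω(|r − r′|)} a_{r′}` pointwise, `Z_N(r) ≤ e^{n_N ω} Z_N(r′)`
   (monotonicity of `posPartition` in the activity) and `|π_N(r) − π_N(r′)| ≤ ω(|r − r′|)` (if one partition function
   vanishes so does the other, and `Real.log 0 = 0`);
3. equicontinuity + pointwise convergence on the compact `[0, t]` ⟹ uniform convergence (finite `δ`-net, `ε/4`).

References: E. Pulvirenti – D. Tsagkarogiannis, Comm. Math. Phys. 316 (2012) Thm 2.1 (canonical cluster expansion,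
the content of `GeneralFamilyLDA`); H. Spohn, Large Scale Dynamics of Interacting Particles (1991), Part I §2.3.
-/

noncomputable section

namespace Summit.AtomisticToContinuum.HydrodynamicLimit.Theorems.NearConstantShortTimeHL

open MeasureTheory Set Filter Topology
open scoped ENNReal
open Literature.MathematicalPhysics.KineticTheory Literature.Analysis.FluidPDE Literature.Analysis.FunctionSpaces

/-! ## Equicontinuity and pointwise convergence on a compact set give uniform convergence -/

/-- **Equicontinuous pointwise limits are uniform on compacts** (real sequences of real functions): if `F_N → f`
pointwise on a compact `K` and the family `(F_N)` admits a modulus of continuity on `K` uniform in `N`, then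
`F_N → f` uniformly on `K` (finite `δ`-net and an `ε/4` argument; the limit inherits the modulus). [folklore] -/
theorem tendstoUniformlyOn_of_equicontinuous {K : Set ℝ} (hK : IsCompact K) {Fs : ℕ → ℝ → ℝ} {f : ℝ → ℝ}
    (hpt : ∀ r ∈ K, Tendsto (fun N => Fs N r) atTop (𝓝 (f r)))
    (hequi : ∀ e : ℝ, 0 < e → ∃ δ : ℝ, 0 < δ ∧ ∀ r ∈ K, ∀ r' ∈ K, dist r r' < δ →
      ∀ N, dist (Fs N r) (Fs N r') ≤ e) :
    TendstoUniformlyOn Fs f atTop K := by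
  rw [Metric.tendstoUniformlyOn_iff]
  intro e he
  have he4 : 0 < e / 4 := by positivity
  obtain ⟨δ, hδ, hmod⟩ := hequi (e / 4) he4
  -- the limit inherits the modulus
  have hlim : ∀ r ∈ K, ∀ r' ∈ K, dist r r' < δ → dist (f r) (f r') ≤ e / 4 := fun r hr r' hr' hd =>
    le_of_tendsto ((hpt r hr).dist (hpt r' hr')) (Eventually.of_forall fun N => hmod r hr r' hr' hd N)
  -- a finite `δ`-net of `K`
  obtain ⟨S, hSK, hSfin, hcover⟩ := finite_cover_balls_of_compact hK hδ
  have hev : ∀ᶠ N in atTop, ∀ p ∈ S, dist (Fs N p) (f p) < e / 4 :=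
    (hSfin.eventually_all).2 fun p hp => Metric.tendsto_nhds.1 (hpt p (hSK hp)) _ he4
  filter_upwards [hev] with N hN r hr
  obtain ⟨p, hp, hrp⟩ := mem_iUnion₂.1 (hcover hr)
  have hrp' : dist r p < δ := hrp
  calc dist (f r) (Fs N r) ≤ dist (f r) (f p) + dist (f p) (Fs N p) + dist (Fs N p) (Fs N r) :=
        dist_triangle4 _ _ _ _
    _ ≤ e / 4 + e / 4 + e / 4 := by
        gcongr
        · exact hlim r hr p (hSK hp) hrp'
        · rw [dist_comm]; exact (hN p hp).le
        · rw [dist_comm]; exact hmod r hr p (hSK hp) hrp' N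
    _ < e := by linarith

/-! ## Partition functions: monotonicity in the activity -/

/-- **Monotonicity of the configurational partition function in the activity**: `0 ≤ a ≤ C b` pointwise gives
`Z(a) ≤ Cⁿ Z(b)` (general diameter `ε` and particle number `n`). [folklore] -/
theorem posPartition_le_pow_mul {a b : T3 → ℝ} (hb : Continuous b) (ha0 : ∀ x, 0 ≤ a x) (hb0 : ∀ x, 0 ≤ b x)
    {C : ℝ} (hle : ∀ x, a x ≤ C * b x) (ε : ℝ) (n : ℕ) :
    posPartition a ε n ≤ C ^ n * posPartition b ε n := by
  have hpt : ∀ x : Fin n → T3, posWeight a ε n x ≤ C ^ n * posWeight b ε n x := by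
    intro x
    unfold posWeight
    by_cases hx : x ∈ posDomain ε n
    · rw [indicator_of_mem hx, indicator_of_mem hx]
      calc ∏ i, a (x i) ≤ ∏ i, C * b (x i) := Finset.prod_le_prod (fun i _ => ha0 _) fun i _ => hle _
        _ = C ^ n * ∏ i, b (x i) := by
            rw [Finset.prod_mul_distrib, Finset.prod_const, Finset.card_univ, Fintype.card_fin]
    · simp [indicator_of_notMem hx]
  rw [posPartition, posPartition, ← integral_const_mul]
  exact integral_mono_of_nonneg (Eventually.of_forall fun x => posWeight_nonneg ha0 ε x)
    ((integrable_posWeight hb hb0 ε n).const_mul _) (Eventually.of_forall hpt)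

/-- **Log-Lipschitz dependence of the pressure per particle on the activity.** If two continuous nonnegative
activities satisfy `a ≤ eᵉ b` and `b ≤ eᵉ a` pointwise (`e ≥ 0`), then `|n⁻¹ log Z(a) − n⁻¹ log Z(b)| ≤ e`: either both
configurational partition functions vanish (`Real.log 0 = 0`) or both are positive and `|log Z(a) − log Z(b)| ≤ n e`.
[folklore] -/
theorem abs_log_posPartition_sub_le {a b : T3 → ℝ} (ha : Continuous a) (hb : Continuous b)
    (ha0 : ∀ x, 0 ≤ a x) (hb0 : ∀ x, 0 ≤ b x) {e : ℝ} (he : 0 ≤ e)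
    (hab : ∀ x, a x ≤ Real.exp e * b x) (hba : ∀ x, b x ≤ Real.exp e * a x) (ε : ℝ) (n : ℕ) :
    |(n : ℝ)⁻¹ * Real.log (posPartition a ε n) - (n : ℝ)⁻¹ * Real.log (posPartition b ε n)| ≤ e := by
  have hZab := posPartition_le_pow_mul hb ha0 hb0 hab ε n
  have hZba := posPartition_le_pow_mul ha hb0 ha0 hba ε n
  have hZa0 := posPartition_nonneg ha0 ε n
  have hZb0 := posPartition_nonneg hb0 ε n
  have hexp : Real.exp e ^ n = Real.exp (n * e) := (Real.exp_nat_mul e n).symm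
  rw [hexp] at hZab hZba
  rw [← mul_sub, abs_mul, abs_of_nonneg (inv_nonneg.2 (Nat.cast_nonneg n))]
  rcases Nat.eq_zero_or_pos n with hn | hn
  · subst hn
    simpa using he
  have hn' : (0 : ℝ) < n := by exact_mod_cast hn
  rw [inv_mul_le_iff₀ hn']
  rcases hZb0.eq_or_lt with hZb | hZb
  · -- `Z(b) = 0`, hence `Z(a) = 0`
    have hZa : posPartition a ε n = 0 := by
      refine le_antisymm ?_ hZa0
      simpa [← hZb] using hZab
    rw [hZa, ← hZb, sub_self, abs_zero]
    positivity
  · -- both positive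
    have hZa : 0 < posPartition a ε n := by
      have h1 : 0 < Real.exp (n * e) * posPartition a ε n := hZb.trans_le hZba
      exact pos_of_mul_pos_right h1 (Real.exp_pos _).le
    have h1 : Real.log (posPartition a ε n) ≤ n * e + Real.log (posPartition b ε n) := by
      have := Real.log_le_log hZa hZab
      rwa [Real.log_mul (Real.exp_pos _).ne' hZb.ne', Real.log_exp] at this
    have h2 : Real.log (posPartition b ε n) ≤ n * e + Real.log (posPartition a ε n) := by
      have := Real.log_le_log hZb hZba
      rwa [Real.log_mul (Real.exp_pos _).ne' hZa.ne', Real.log_exp] at this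
    rw [abs_sub_le_iff]
    constructor <;> linarith

/-- **Pressures per particle of two local Gibbs profiles with comparable activities.** For continuous profiles with
nonnegative activities `a ≤ eᵉ b`, `b ≤ eᵉ a` and positive temperatures, the pressures per particle
`n⁻¹ log 𝒵_n` of `localGibbsProfile a u θ` and `localGibbsProfile b w ϑ` are `e`-close: the canonical partition
function only sees the activity (`canonicalPartition_eq_posPartition`). [folklore] -/
theorem dist_logCanonicalPartition_le {a b θ ϑ : T3 → ℝ} {u w : T3 → V3} (ha : Continuous a) (hθ : Continuous θ)
    (hu : Continuous u) (hb : Continuous b) (hϑ : Continuous ϑ) (hw : Continuous w) (ha0 : ∀ x, 0 ≤ a x)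
    (hb0 : ∀ x, 0 ≤ b x) (hθ0 : ∀ x, 0 < θ x) (hϑ0 : ∀ x, 0 < ϑ x) {e : ℝ} (he : 0 ≤ e)
    (hab : ∀ x, a x ≤ Real.exp e * b x) (hba : ∀ x, b x ≤ Real.exp e * a x) (ε : ℝ) (n : ℕ) :
    dist ((n : ℝ)⁻¹ * Real.log (canonicalPartition (Torus.geometry (Fin 3)) ε n (localGibbsProfile a u θ)))
      ((n : ℝ)⁻¹ * Real.log (canonicalPartition (Torus.geometry (Fin 3)) ε n (localGibbsProfile b w ϑ))) ≤ e := by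
  rw [canonicalPartition_eq_posPartition ha hθ hu ha0 hθ0, canonicalPartition_eq_posPartition hb hϑ hw hb0 hϑ0,
    Real.dist_eq]
  exact abs_log_posPartition_sub_le ha hb ha0 hb0 he hab hba ε n

/-! ## A uniform-in-space modulus of continuity in time -/

/-- **Uniform-in-space modulus of continuity in time.** If the space–time lift of `ρ` is continuous on
`[0, t] × ℝ³`, `G` is continuous on a set `U` containing all values `ρ_r(x)`, `r ∈ [0, t]`, then
`(r, x) ↦ G(ρ_r(x))` is uniformly continuous in `r ∈ [0, t]`, uniformly in `x ∈ 𝕋³` (Heine–Cantor on the compact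
`[0, t] × [0, 1]³`, whose image under `proj` covers the torus). [folklore] -/
theorem exists_modulus_comp_density {ρ : ℝ → T3 → ℝ} {G : ℝ → ℝ} {U : Set ℝ} {t : ℝ}
    (hρ : ContinuousOn (Torus.stLift ρ) (Icc 0 t ×ˢ univ)) (hG : ContinuousOn G U)
    (hU : ∀ r ∈ Icc 0 t, ∀ x, ρ r x ∈ U) {e : ℝ} (he : 0 < e) :
    ∃ δ : ℝ, 0 < δ ∧ ∀ r ∈ Icc 0 t, ∀ r' ∈ Icc 0 t, dist r r' < δ →
      ∀ x, dist (G (ρ r x)) (G (ρ r' x)) < e := by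
  set K : Set (ℝ × EuclideanSpace ℝ (Fin 3)) :=
    Icc 0 t ×ˢ ((WithLp.toLp 2) '' (Set.pi univ fun _ : Fin 3 => Icc (0 : ℝ) 1)) with hK
  have hKc : IsCompact K := isCompact_Icc.prod Torus.isCompact_toLp_image_pi_Icc
  have hcomp : ContinuousOn (fun p => G (Torus.stLift ρ p)) (Icc 0 t ×ˢ univ) :=
    hG.comp hρ fun p hp => hU p.1 hp.1 (Torus.proj p.2)
  have hUC : UniformContinuousOn (fun p => G (Torus.stLift ρ p)) K :=
    hKc.uniformContinuousOn_of_continuous (hcomp.mono (prod_mono Subset.rfl (subset_univ _)))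
  obtain ⟨δ, hδ, h⟩ := Metric.uniformContinuousOn_iff.1 hUC e he
  refine ⟨δ, hδ, fun r hr r' hr' hd x => ?_⟩
  have h1 := h (r, Torus.repr x) ⟨hr, Torus.repr_mem_toLp_image_pi_Icc x⟩ (r', Torus.repr x)
    ⟨hr', Torus.repr_mem_toLp_image_pi_Icc x⟩
    (by rw [Prod.dist_eq, dist_self, max_eq_left dist_nonneg]; exact hd)
  simpa only [Torus.stLift_apply, Torus.proj_repr] using h1

/-! ## The stub, explicit form -/

/-- **St3, explicit form — UNIFORM PRESSURES ALONG A CLASSICAL SOLUTION.** There is a packing threshold `η₁ > 0`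
(the minimum of the threshold of `GeneralFamilyLDA` and of the analyticity band of the equation of state) such that
for every `σ > 0`, every admissible family and every classical hs-Euler solution `(ρ, u, θ)` on `[0, T)` of unit mass
whose packing stays `< η₁` on `[0, t]` (`t < T`), the pressures per particle of the matched canonical local Gibbs laws
converge to `∫ ρ_r · ρ_r σ³ f_ex′(ρ_r σ³)` UNIFORMLY in `r ∈ [0, t]`. Pointwise: `stub_ldaGeneralFamilies` (i) with
mass conservation; uniformity: the exponent `log ρ_r + g_σ(ρ_r)` of the activity is uniformly continuous on
`[0, t] × 𝕋³`, the configurational partition function is monotone in the activity, so the pressures per particle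
are equicontinuous in `r` uniformly in `N`, and equicontinuous pointwise limits on a compact interval are uniform.
[cite: PulvirentiTsagkarogiannis2012, Thm 2.1] -/
theorem uniformPressure_explicit :
    ∃ η₁ : ℝ, 0 < η₁ ∧ ∀ σ : ℝ, 0 < σ →
    let g : ℝ → ℝ := fun r => hsExcessFreeEnergy (r * σ ^ 3) + r * σ ^ 3 * deriv hsExcessFreeEnergy (r * σ ^ 3);
    ∀ (ε : ℕ → ℝ) (n : ℕ → ℕ), (∀ N, 0 < ε N) → Tendsto ε atTop (nhds 0) →
    Tendsto (fun N => (n N : ℝ) * ε N ^ 3) atTop (nhds (σ ^ 3)) →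
    ∀ (T : ℝ) (ρ θ : ℝ → T3 → ℝ) (u : ℝ → T3 → V3), IsHardSphereEulerSolution σ T ρ u θ →
    (∫ x, ρ 0 x) = 1 → ∀ t ∈ Set.Ico 0 T, (∀ s ∈ Set.Icc 0 t, ∀ x, ρ s x * σ ^ 3 < η₁) →
    TendstoUniformlyOn
      (fun N r => (n N : ℝ)⁻¹ * Real.log (canonicalPartition (Torus.geometry (Fin 3)) (ε N) (n N)
        (localGibbsProfile (fun x => ρ r x * Real.exp (g (ρ r x))) (u r) (θ r))))
      (fun r => ∫ x, ρ r x * (ρ r x * σ ^ 3 * deriv hsExcessFreeEnergy (ρ r x * σ ^ 3)))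
      atTop (Set.Icc 0 t) := by
  obtain ⟨ηL, hηL, H1⟩ := stub_ldaGeneralFamilies
  obtain ⟨ηE, hηE, F, hFa, hEqF, -, -, -⟩ := hsEosLowDensity_proof
  -- the excess free energy is smooth on the open band `(0, ηE)`
  have hfex : ContDiffOn ℝ ((⊤ : ℕ∞) : WithTop ℕ∞) hsExcessFreeEnergy (Ioo 0 ηE) :=
    (hFa.contDiffOn_of_completeSpace.mono (Ioo_subset_Ioo (by linarith) le_rfl)).congr
      fun r hr => hEqF ⟨hr.1.le, hr.2⟩
  refine ⟨min ηL ηE, lt_min hηL hηE, ?_⟩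
  intro σ hσ g ε n hε hε0 hn T ρ θ u hE hmass0 t ht hpack
  have hσ3 : 0 < σ ^ 3 := pow_pos hσ 3
  have htT : Icc 0 t ⊆ Ico 0 T := Icc_subset_Ico_right ht.2
  -- the band `U` of the density values and the exponent `G = log + g_σ` of the activity, continuous on `U`
  set U : Set ℝ := {r | 0 < r ∧ r * σ ^ 3 < ηE} with hUdef
  have hGc : ContinuousOn (fun r => Real.log r + g r) U := by
    have hmaps : MapsTo (fun r : ℝ => r * σ ^ 3) U (Ioo 0 ηE) := fun r hr => ⟨mul_pos hr.1 hσ3, hr.2⟩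
    have hmul : Continuous fun r : ℝ => r * σ ^ 3 := continuous_id.mul continuous_const
    have h1 : ContinuousOn (fun r => hsExcessFreeEnergy (r * σ ^ 3)) U :=
      hfex.continuousOn.comp hmul.continuousOn hmaps
    have h2 : ContinuousOn (fun r => deriv hsExcessFreeEnergy (r * σ ^ 3)) U :=
      (hfex.continuousOn_deriv_of_isOpen isOpen_Ioo (by simp)).comp hmul.continuousOn hmaps
    have hlog : ContinuousOn Real.log U := Real.continuousOn_log.mono fun r hr => hr.1.ne'
    exact hlog.add (h1.add (hmul.continuousOn.mul h2))
  have hUρ : ∀ r ∈ Icc 0 t, ∀ x, ρ r x ∈ U := fun r hr x =>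
    ⟨hE.density_pos r (htT hr) x, (hpack r hr x).trans_le (min_le_right _ _)⟩
  -- the time slices of the solution
  have hslice : ∀ r ∈ Icc 0 t, Continuous (ρ r) ∧ Continuous (θ r) ∧ Continuous (u r) ∧
      (∀ x, 0 < ρ r x) ∧ (∀ x, 0 < θ r x) := fun r hr =>
    ⟨(hE.smooth_density.isSmooth_slice (htT hr)).continuous,
      (hE.smooth_temperature.isSmooth_slice (htT hr)).continuous,
      (hE.smooth_velocity.isSmooth_slice (htT hr)).continuous, hE.density_pos r (htT hr),
      hE.temperature_pos r (htT hr)⟩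
  -- the activity is `exp ∘ G ∘ ρ_r`
  have ha_eq : ∀ r x, 0 < ρ r x → Real.exp (Real.log (ρ r x) + g (ρ r x)) = ρ r x * Real.exp (g (ρ r x)) :=
    fun r x h => by rw [Real.exp_add, Real.exp_log h]
  have ha_c : ∀ r ∈ Icc 0 t, Continuous fun x => ρ r x * Real.exp (g (ρ r x)) := by
    intro r hr
    have h : Continuous fun x => Real.exp (Real.log (ρ r x) + g (ρ r x)) :=
      Real.continuous_exp.comp (hGc.comp_continuous (hslice r hr).1 (hUρ r hr))
    exact h.congr fun x => ha_eq r x ((hslice r hr).2.2.2.1 x)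
  refine tendstoUniformlyOn_of_equicontinuous isCompact_Icc ?_ ?_
  · -- pointwise convergence: `GeneralFamilyLDA` (i) at the slice `r`
    intro r hr
    obtain ⟨hρc, hθc, huc, hρ0, hθ0⟩ := hslice r hr
    obtain ⟨xm, -, hxm⟩ := isCompact_univ.exists_isMinOn univ_nonempty hρc.continuousOn
    have hband : ∀ x, ρ r xm ≤ ρ r x ∧ ρ r x * σ ^ 3 ≤ ηL := fun x =>
      ⟨hxm (mem_univ x), (hpack r hr x).le.trans (min_le_left _ _)⟩
    have hmass : ∫ x, ρ r x = 1 := (DenseExcursionEverywhere.integral_density_eq hE (htT hr)).trans hmass0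
    exact (H1 σ hσ (ρ r xm) (hρ0 xm) (ρ r) hρc hband hmass (u r) (θ r) huc hθc hθ0 ε n hε hε0 hn).1
  · -- equicontinuity in `r`, uniformly in `N`
    intro e he
    obtain ⟨δ, hδ, hmod⟩ := exists_modulus_comp_density
      (hE.smooth_density.continuousOn_stLift.mono (prod_mono htT Subset.rfl)) hGc hUρ he
    refine ⟨δ, hδ, fun r hr r' hr' hd N => ?_⟩
    obtain ⟨-, hθc, huc, hρ0, hθ0⟩ := hslice r hr
    obtain ⟨-, hθc', huc', hρ0', hθ0'⟩ := hslice r' hr'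
    have hcmp : ∀ {s s' : ℝ} (x : T3), 0 < ρ s x → 0 < ρ s' x →
        dist (Real.log (ρ s x) + g (ρ s x)) (Real.log (ρ s' x) + g (ρ s' x)) < e →
        ρ s x * Real.exp (g (ρ s x)) ≤ Real.exp e * (ρ s' x * Real.exp (g (ρ s' x))) := by
      intro s s' x hs hs' hdist
      rw [Real.dist_eq] at hdist
      calc ρ s x * Real.exp (g (ρ s x)) = Real.exp (Real.log (ρ s x) + g (ρ s x)) := (ha_eq s x hs).symm
        _ ≤ Real.exp (e + (Real.log (ρ s' x) + g (ρ s' x))) :=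
            Real.exp_le_exp.2 (by linarith [(abs_lt.1 hdist).2])
        _ = Real.exp e * (ρ s' x * Real.exp (g (ρ s' x))) := by rw [Real.exp_add, ha_eq s' x hs']
    have h1 : ∀ x, ρ r x * Real.exp (g (ρ r x)) ≤ Real.exp e * (ρ r' x * Real.exp (g (ρ r' x))) := fun x =>
      hcmp x (hρ0 x) (hρ0' x) (hmod r hr r' hr' hd x)
    have h2 : ∀ x, ρ r' x * Real.exp (g (ρ r' x)) ≤ Real.exp e * (ρ r x * Real.exp (g (ρ r x))) := fun x => by
      refine hcmp x (hρ0' x) (hρ0 x) ?_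
      rw [dist_comm]
      exact hmod r hr r' hr' hd x
    exact dist_logCanonicalPartition_le (ha_c r hr) hθc huc (ha_c r' hr') hθc' huc'
      (fun x => (mul_pos (hρ0 x) (Real.exp_pos _)).le) (fun x => (mul_pos (hρ0' x) (Real.exp_pos _)).le)
      hθ0 hθ0' he.le h1 h2 (ε N) (n N)

/-! ## The registered stub -/

/-- **St3 — `stub_uniformPressure : UniformPressureAlongSolution`** (registered stub of crux stmt-AtomisticToContinuum-12502,
line `small-tilt-domination`; statics input of the lead's Gronwall `stub_meanFieldGronwall`): the pressures per particle
of the Euler-matched canonical local Gibbs laws converge uniformly in `r ∈ [0, t]` along a classical hs-Euler solution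
of unit mass in the dilute band. This is `uniformPressure_explicit`, verbatim the body of `UniformPressureAlongSolution`.
[cite: PulvirentiTsagkarogiannis2012, Thm 2.1] -/
theorem stub_uniformPressure : UniformPressureAlongSolution :=
  uniformPressure_explicit

end Summit.AtomisticToContinuum.HydrodynamicLimit.Theorems.NearConstantShortTimeHL

end
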